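import Summits.PneNP.PneNP.Theses.PhaseTwins
import Summits.PneNP.PneNP.Theorems.PhaseTwinsDensityContinuityBelowHomCount
import Literature.Probability.LatticeModels.IndependencePolynomialProofs
import Literature.Analysis.Complex.BarvinokInterpolation
import Literature.Analysis.Complex.BarvinokDiscToStrip

/-!
# Route PhaseTwins: `DensityContinuityBelow` (stmt-PneNP-2725) — proved, unconditionally

`densityContinuityBelow_proof : Summit.PneNP.PneNP.Theses.PhaseTwins.DensityContinuityBelow`:
for `Δ ≥ 3`, `0 ≤ λ < λ_c(Δ) = (Δ-1)^{Δ-1}/(Δ-2)^Δ` and `δ > 0` there is `k` such that any two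
graphs `G`, `H` on `n` vertices of maximum degree `≤ Δ` that are homomorphism-indistinguishable
over graphs of treewidth `< k` satisfy `Z_G(λ) ≤ e^{δ n} Z_H(λ)` (`Z` the independence polynomial /
hard-core partition function).

Proof (zero-freeness + interpolation, with a CONSTANT truncation order; not the Weitz /
Borgs–Chayes–Kahn–Lovász correlation-decay route of the item's docstring, whose analytic input is
only a named fact in the tree). All analytic ingredients are PROVED Literature theorems:
* `PetersRegts2019_zeroFree_holds` (Peters–Regts 2019, Thm 1.1, Sokal's conjecture) through
  `PetersRegts2019_zeroFree.exists_thickening`: a `δ'`-neighbourhood of `[0, λ]` is zero-free for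
  all graphs of maximum degree `≤ Δ`;
* Barvinok's disc-to-strip polynomial `φ_ρ` (`DiscToStrip.phi`, Barvinok 2016 Lemma 2.2.3): with
  `4ρλ < δ'`, `z ↦ λ φ_ρ(z)` maps the disc `‖z‖ ≤ β(ρ)`, `β(ρ) > 1`, into that neighbourhood
  (`exists_near_segment`), so `P_G = Z_G ∘ (λ φ_ρ)` has no zeros in `‖z‖ < β`, degree `≤ n N(ρ)`,
  and `P_G(1) = Z_G(λ)`;
* Barvinok's interpolation lemma with the Newton identities
  (`abs_log_norm_eval_sub_log_norm_eval_le`, Barvinok 2016 Lemma 2.2.1 + §2.2.2): if `P_G`, `P_H`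
  agree in degrees `≤ m` then `|log Z_G(λ) - log Z_H(λ)| ≤ 2 n N / ((m+1) β^m (β-1)) ≤ δ n` for
  `m = m(Δ, λ, δ)` with `β^m > 2N/(δ(β-1))` — independent of `n` (`exists_order_of_coeff`).
The combinatorial input is `PhaseTwinsDensityContinuityBelowHomCount`: hom-indistinguishability
over treewidth `< m + 1` covers all graphs on `≤ m` vertices (`treewidth_le_card_sub_one`), whose
hom counts determine the numbers of independent sets of each size `≤ m`
(`natCard_indepSets_eq_of_homCount_eq`), i.e. the coefficients of `Z_G` up to degree `m`
(`coeff_indepPoly`), which survive the substitution `ψ = λ φ_ρ`, `ψ(0) = 0`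
(`coeff_comp_eq_of_coeff_eq`).

No named facts, no new definitions; axioms `propext`, `Classical.choice`, `Quot.sound`.
-/

noncomputable section

/-! ### The independence polynomial as a complex polynomial: values, coefficients, degree -/

namespace Summit.PneNP.PneNP.Theorems

-- `Summit.PneNP.PneNP` is the harness layout (summit = problem), not an accidental duplication.
set_option linter.dupNamespace false

namespace DensityContinuityBelow

open Finset Polynomial
open Literature.Probability.LatticeModels Literature.Analysis.Complex
open Literature.Combinatorics.SimpleGraph (treewidth_le_card_sub_one)

section IndepPoly

variable {V : Type*} [Fintype V] [DecidableEq V] (G : SimpleGraph V) [DecidableRel G.Adj]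

/-- The polynomial `∑_{I independent} X^{|I|} ∈ ℂ[X]` evaluates to the independence polynomial
`Z_G` of the tree (`Literature.Probability.LatticeModels.independencePolynomial`). -/
theorem eval_indepPoly (z : ℂ) :
    (∑ I : Finset V, if G.IsIndepSet ↑I then (X : ℂ[X]) ^ I.card else 0).eval z =
      independencePolynomial G z := by
  rw [eval_finsetSum, independencePolynomial]
  refine sum_congr rfl fun I _ => ?_
  split_ifs <;> simp

/-- Its `j`-th coefficient is the number `i_j(G)` of independent sets of size `j`. -/
theorem coeff_indepPoly (j : ℕ) :
    (∑ I : Finset V, if G.IsIndepSet ↑I then (X : ℂ[X]) ^ I.card else 0).coeff j =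
      (Nat.card {I : Finset V // G.IsIndepSet ↑I ∧ I.card = j} : ℂ) := by
  rw [finsetSum_coeff, Nat.subtype_card (univ.filter fun I : Finset V =>
      G.IsIndepSet ↑I ∧ I.card = j) (fun I => by simp), natCast_card_filter]
  refine sum_congr rfl fun I _ => ?_
  by_cases hp : G.IsIndepSet ↑I
  · by_cases hc : I.card = j
    · simp [hp, hc]
    · simp [hp, hc, coeff_X_pow, Ne.symm hc]
  · simp [hp]

/-- Its degree is at most `|V|`. -/
theorem natDegree_indepPoly_le :
    (∑ I : Finset V, if G.IsIndepSet ↑I then (X : ℂ[X]) ^ I.card else 0).natDegree ≤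
      Fintype.card V := by
  refine natDegree_sum_le_of_forall_le _ _ fun I _ => ?_
  split_ifs
  · exact (natDegree_X_pow_le _).trans I.card_le_univ
  · simp

end IndepPoly

/-- Composition with a polynomial vanishing at `0` preserves agreement of low coefficients:
if `P ≡ Q (mod X^{m+1})` and `ψ(0) = 0` then `P ∘ ψ ≡ Q ∘ ψ (mod X^{m+1})`. -/
theorem coeff_comp_eq_of_coeff_eq {R : Type*} [CommRing R] {P Q ψ : R[X]} (hψ : ψ.coeff 0 = 0)
    {m : ℕ} (h : ∀ i ≤ m, P.coeff i = Q.coeff i) :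
    ∀ i ≤ m, (P.comp ψ).coeff i = (Q.comp ψ).coeff i := by
  have hdvd : X ^ (m + 1) ∣ P - Q :=
    X_pow_dvd_iff.2 fun d hd => by rw [coeff_sub, h d (by omega), sub_self]
  obtain ⟨R', hR'⟩ := hdvd
  have hX : X ∣ ψ := X_dvd_iff.2 hψ
  have hcomp : X ^ (m + 1) ∣ P.comp ψ - Q.comp ψ := by
    rw [← sub_comp, hR', mul_comp, X_pow_comp]
    exact Dvd.dvd.mul_right (pow_dvd_pow_of_dvd hX _) _
  intro i hi
  have := (X_pow_dvd_iff.1 hcomp) i (by omega)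
  rwa [coeff_sub, sub_eq_zero] at this

/-- A point of Barvinok's rectangle `-ρ ≤ Re w ≤ 1 + 2ρ`, `|Im w| ≤ 2ρ` lies within `4ρ` of a
point of the segment `[0, 1]` (namely of the clamp of `Re w`). -/
theorem exists_near_segment {ρ : ℝ} (hρ : 0 ≤ ρ) {w : ℂ} (h1 : -ρ ≤ w.re) (h2 : w.re ≤ 1 + 2 * ρ)
    (h3 : |w.im| ≤ 2 * ρ) : ∃ t : ℝ, 0 ≤ t ∧ t ≤ 1 ∧ ‖w - t‖ ≤ 4 * ρ := by
  refine ⟨min (max w.re 0) 1, le_min (le_max_right _ _) zero_le_one, min_le_right _ _, ?_⟩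
  refine (Complex.norm_le_abs_re_add_abs_im _).trans ?_
  have hre : |(w - ((min (max w.re 0) 1 : ℝ) : ℂ)).re| ≤ 2 * ρ := by
    rw [Complex.sub_re, Complex.ofReal_re]
    rcases le_total w.re 0 with hw0 | hw0
    · rw [max_eq_right hw0, min_eq_left zero_le_one]
      rw [abs_le]; constructor <;> linarith
    · rw [max_eq_left hw0]
      rcases le_total w.re 1 with hw1 | hw1
      · rw [min_eq_left hw1, sub_self, abs_zero]; linarith
      · rw [min_eq_right hw1, abs_le]; constructor <;> linarith
  have him : |(w - ((min (max w.re 0) 1 : ℝ) : ℂ)).im| ≤ 2 * ρ := by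
    rwa [Complex.sub_im, Complex.ofReal_im, sub_zero]
  linarith

/-- **Density continuity below `λ_c`, coefficient form.** For `Δ ≥ 3`, `0 ≤ λ < λ_c(Δ)` and `δ > 0`
there is `m` such that any two graphs `G`, `H` on `n` vertices of maximum degree at most `Δ` with
the same numbers of independent sets of each size `j ≤ m` satisfy `Z_G(λ) ≤ e^{δ n} Z_H(λ)`.
Proof: Peters–Regts zero-freeness of a `δ'`-neighbourhood of `[0, λ]`
(`PetersRegts2019_zeroFree_holds`, proved in the tree), Barvinok's disc-to-strip polynomial `φ_ρ`
with `4ρλ < δ'` (`DiscToStrip.phi_eval_mem_strip`), and Barvinok's interpolation lemma for the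
polynomials `Z_G(λ φ_ρ(z))`, `Z_H(λ φ_ρ(z))` of degree `≤ n N(ρ)`, zero-free on `‖z‖ < β(ρ)` and
with equal coefficients up to degree `m` (`abs_log_norm_eval_sub_log_norm_eval_le`): the error
`2 n N/((m+1) β^m (β-1))` is `≤ δ n` once `β^m > 2N/(δ(β-1))`. -/
theorem exists_order_of_coeff
    {Δ : ℕ} (hΔ : 3 ≤ Δ) {lam : ℝ} (h0 : 0 ≤ lam) (hlt : lam < hardCoreThreshold Δ)
    {δ : ℝ} (hδ : 0 < δ) :
    ∃ m : ℕ, ∀ (n : ℕ) (G H : SimpleGraph (Fin n)) {iG : DecidableRel G.Adj}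
      {iH : DecidableRel H.Adj}, G.maxDegree ≤ Δ → H.maxDegree ≤ Δ →
      (∀ j ≤ m, Nat.card {I : Finset (Fin n) // G.IsIndepSet ↑I ∧ I.card = j} =
        Nat.card {I : Finset (Fin n) // H.IsIndepSet ↑I ∧ I.card = j}) →
      independencePolynomial G lam ≤ Real.exp (δ * n) * independencePolynomial H lam := by
  -- the zero-free neighbourhood of `[0, λ]`
  obtain ⟨δ', hδ', hZ⟩ := PetersRegts2019_zeroFree_holds.exists_thickening hΔ hlt
  -- the width `ρ` of Barvinok's rectangle: `4 ρ λ < δ'`, `0 < ρ < 1`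
  set ρ : ℝ := min (1 / 2) (δ' / (4 * lam + 4)) with hρ
  have hρ0 : 0 < ρ := lt_min (by norm_num) (div_pos hδ' (by linarith))
  have hρ1 : ρ < 1 := (min_le_left _ _).trans_lt (by norm_num)
  have hρδ : 4 * ρ * lam < δ' := by
    have h1 : ρ ≤ δ' / (4 * lam + 4) := min_le_right _ _
    rw [le_div_iff₀ (by linarith)] at h1
    nlinarith
  set β : ℝ := DiscToStrip.beta ρ with hβ
  have hβ1 : 1 < β := DiscToStrip.one_lt_beta hρ0
  set N : ℕ := DiscToStrip.degree ρ with hN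
  -- the truncation order `m`: `β^m > 2N / (δ (β - 1))`
  obtain ⟨m, hm⟩ := pow_unbounded_of_one_lt (2 * N / (δ * (β - 1))) hβ1
  refine ⟨m, fun n G H iG iH hG hH hcoef => ?_⟩
  -- the substitution `ψ = λ φ_ρ`
  set ψ : ℂ[X] := C (lam : ℂ) * DiscToStrip.phi ρ with hψ
  have hψ0 : ψ.coeff 0 = 0 := by
    rw [hψ, coeff_C_mul, coeff_zero_eq_eval_zero, DiscToStrip.phi_eval_zero, mul_zero]
  have hψ1 : ψ.eval 1 = lam := by
    rw [hψ, eval_mul, eval_C, DiscToStrip.phi_eval_one hρ0, mul_one]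
  have hψdeg : ψ.natDegree ≤ N :=
    (natDegree_C_mul_le _ _).trans (DiscToStrip.natDegree_phi_le ρ)
  -- zero-freeness of `Z_K ∘ ψ` on the disc `‖z‖ < β` for every `K` of maximum degree `≤ Δ`
  have hfree : ∀ (K : SimpleGraph (Fin n)) {iK : DecidableRel K.Adj}, K.maxDegree ≤ Δ →
      ∀ z : ℂ, ‖z‖ < β →
        ((∑ I : Finset (Fin n), if K.IsIndepSet ↑I then (X : ℂ[X]) ^ I.card else 0).comp ψ).eval z
          ≠ 0 := by
    intro K iK hK z hz
    rw [eval_comp, eval_indepPoly]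
    obtain ⟨hre1, hre2, him⟩ := DiscToStrip.phi_eval_mem_strip hρ0 hρ1 hz.le
    obtain ⟨t, ht0, ht1, hwt⟩ := exists_near_segment hρ0.le hre1 hre2 him
    refine hZ (Fin n) K hK (ψ.eval z) (lam * t) (mul_nonneg h0 ht0)
      (mul_le_of_le_one_right h0 ht1) ?_
    rw [dist_eq_norm, hψ, eval_mul, eval_C, Complex.ofReal_mul, ← mul_sub, norm_mul,
      Complex.norm_real, Real.norm_of_nonneg h0]
    calc lam * ‖(DiscToStrip.phi ρ).eval z - (t : ℂ)‖ ≤ lam * (4 * ρ) :=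
          mul_le_mul_of_nonneg_left hwt h0
      _ = 4 * ρ * lam := by ring
      _ < δ' := hρδ
  -- the two polynomials
  set P : ℂ[X] :=
    (∑ I : Finset (Fin n), if G.IsIndepSet ↑I then (X : ℂ[X]) ^ I.card else 0).comp ψ with hP
  set Q : ℂ[X] :=
    (∑ I : Finset (Fin n), if H.IsIndepSet ↑I then (X : ℂ[X]) ^ I.card else 0).comp ψ with hQ
  have hPfree : ∀ z : ℂ, ‖z‖ < β → P.eval z ≠ 0 := hfree G hG
  have hQfree : ∀ z : ℂ, ‖z‖ < β → Q.eval z ≠ 0 := hfree H hH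
  have hPQ : ∀ i ≤ m, P.coeff i = Q.coeff i :=
    coeff_comp_eq_of_coeff_eq hψ0 fun i hi => by
      rw [coeff_indepPoly, coeff_indepPoly, hcoef i hi]
  have hPdeg : P.natDegree ≤ n * N := by
    refine natDegree_comp_le.trans (Nat.mul_le_mul ?_ hψdeg)
    simpa using natDegree_indepPoly_le G
  have hQdeg : Q.natDegree ≤ n * N := by
    refine natDegree_comp_le.trans (Nat.mul_le_mul ?_ hψdeg)
    simpa using natDegree_indepPoly_le H
  -- values at `z = 1`
  have hP1 : ‖P.eval 1‖ = independencePolynomial G lam := by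
    rw [hP, eval_comp, hψ1, eval_indepPoly, ← ofReal_independencePolynomial, Complex.norm_real,
      Real.norm_of_nonneg (independencePolynomial_pos G h0).le]
  have hQ1 : ‖Q.eval 1‖ = independencePolynomial H lam := by
    rw [hQ, eval_comp, hψ1, eval_indepPoly, ← ofReal_independencePolynomial, Complex.norm_real,
      Real.norm_of_nonneg (independencePolynomial_pos H h0).le]
  -- Barvinok's interpolation lemma
  have hB := abs_log_norm_eval_sub_log_norm_eval_le hβ1 hPfree hQfree hPQ (z := 1) (by simp)
  rw [hP1, hQ1] at hB
  -- the error is at most `δ n`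
  have hD : 0 < ((m : ℝ) + 1) * β ^ m * (β - 1) := by
    have : 0 < β - 1 := sub_pos.2 hβ1
    positivity
  have hNδ : (2 * N : ℝ) ≤ δ * (((m : ℝ) + 1) * β ^ m * (β - 1)) := by
    have hβ0 : 0 < β - 1 := sub_pos.2 hβ1
    rw [div_lt_iff₀ (by positivity)] at hm
    have h1 : δ * (β - 1) * β ^ m ≤ δ * (((m : ℝ) + 1) * β ^ m * (β - 1)) := by
      have : (1 : ℝ) ≤ (m : ℝ) + 1 := by
        have := (Nat.cast_nonneg m : (0 : ℝ) ≤ m); linarith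
      calc δ * (β - 1) * β ^ m = δ * (1 * β ^ m * (β - 1)) := by ring
        _ ≤ δ * (((m : ℝ) + 1) * β ^ m * (β - 1)) := by gcongr
    linarith
  have herr : ((P.natDegree : ℝ) + Q.natDegree) / (((m : ℝ) + 1) * β ^ m * (β - 1)) ≤ δ * n := by
    rw [div_le_iff₀ hD]
    have h1 : ((P.natDegree : ℝ) + Q.natDegree) ≤ n * (2 * N) := by
      have hP' : (P.natDegree : ℝ) ≤ n * N := by exact_mod_cast hPdeg
      have hQ' : (Q.natDegree : ℝ) ≤ n * N := by exact_mod_cast hQdeg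
      linarith
    calc ((P.natDegree : ℝ) + Q.natDegree) ≤ n * (2 * N) := h1
      _ ≤ n * (δ * (((m : ℝ) + 1) * β ^ m * (β - 1))) :=
          mul_le_mul_of_nonneg_left hNδ (Nat.cast_nonneg n)
      _ = δ * n * (((m : ℝ) + 1) * β ^ m * (β - 1)) := by ring
  have hlog : Real.log (independencePolynomial G lam) ≤
      Real.log (independencePolynomial H lam) + δ * n := by
    have := (abs_le.1 (hB.trans herr)).2
    linarith
  calc independencePolynomial G lam = Real.exp (Real.log (independencePolynomial G lam)) :=
        (Real.exp_log (independencePolynomial_pos G h0)).symm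
    _ ≤ Real.exp (Real.log (independencePolynomial H lam) + δ * n) := Real.exp_le_exp.2 hlog
    _ = Real.exp (δ * n) * independencePolynomial H lam := by
        rw [Real.exp_add, Real.exp_log (independencePolynomial_pos H h0), mul_comm]

end DensityContinuityBelow

open DensityContinuityBelow Literature.Combinatorics.SimpleGraph in
/-- **`DensityContinuityBelow` holds** (route PhaseTwins, item stmt-PneNP-2725): below the
tree-uniqueness threshold, hom-indistinguishability over treewidth `< k = m + 1` of two
max-degree-`≤ Δ` graphs on `n` vertices forces `Z_G(λ) ≤ e^{δ n} Z_H(λ)`. Graphs on `s ≤ m`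
vertices have treewidth `≤ s - 1 < k`, so the hom counts of all of them agree, hence
(`natCard_indepSets_eq_of_homCount_eq`) the numbers of independent sets of each size `≤ m` agree,
and `exists_order_of_coeff` applies. Unconditional: the Peters–Regts theorem and Barvinok's lemmas
it rests on are proved in the tree. -/
theorem densityContinuityBelow_proof :
    Summit.PneNP.PneNP.Theses.PhaseTwins.DensityContinuityBelow := by
  unfold Summit.PneNP.PneNP.Theses.PhaseTwins.DensityContinuityBelow
  intro Δ hΔ lam h0 hlt δ hδ
  obtain ⟨m, hm⟩ := exists_order_of_coeff hΔ h0 hlt hδ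
  refine ⟨m + 1, fun n G H hG hH hhom => ?_⟩
  have hcount : ∀ j ≤ m, Nat.card {I : Finset (Fin n) // G.IsIndepSet ↑I ∧ I.card = j} =
      Nat.card {I : Finset (Fin n) // H.IsIndepSet ↑I ∧ I.card = j} := fun j hj =>
    natCard_indepSets_eq_of_homCount_eq G H (m := m)
      (fun s hs F => hhom s F (lt_of_le_of_lt (treewidth_le_card_sub_one F)
        (by rw [Fintype.card_fin]; omega))) hj
  exact hm n G H hG hH hcount

end Summit.PneNP.PneNP.Theorems
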